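import Summits.QuantumFields.YangMills.Theorems.AlphaInputsT3ACv3LocalSmallT3Read
import Summits.QuantumFields.YangMills.Theorems.BalabanUVNodesN08AlphaHistGeom
import HarnessLib

/-!
# `AlphaInputsT3ACv3LocalSmallT3Hook` — STRATEGY B for 2′: THE (D6L)-CORE INTERFACE IN PURELY GEOMETRIC FORM — `U ∈ localSmallT3 k h` as soon as the fine plaquettes of
# `U` within `ℓ¹`-distance `39·L^{i₀}` of a READ REGION `lam42 Ω(h) k i` (`i₀ ≤ i ≤ k`) are `α₀·(L^{i₀})⁻²`-small — lane `pub-balaban3d`, seat alpha-2 (g2)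

WHAT.  `AlphaInputsT3AC.localSmallT3_of_plaqSmallOn_readBoxes` (sibling `…LocalSmallT3Read`: one fine box `boxRegion (toFine i₀ c₀.src) (13·L^{i₀})` per read bond) with the
boxes dissolved into a distance condition: a plaquette of that box has its base point within `ℓ¹` torus distance `3·13·L^{i₀}` of `toFine i₀ c₀.src ∈ lam42 Ω(h) k i`
(`tdist_le_of_mem_boxRegion`: `|valMinAbs| ≤ |offset|`, `ZMod.natAbs_min_of_le_div_two`), hence within `39·L^{i₀}` of the read region (NODE O's `distTo`).
★ `AlphaInputsT3AC.localSmallT3_of_plaqSmall_near_reads`: no bonds, boxes or chains in the hypothesis — only «fine plaquettes near `Λ_i(h)` (resp. `Ω_k(h)`) are small at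
scale `L^{−2i₀}` for every `i₀ ≤ i`», which is what a regular profile with cut-offs `θ_i ≡ 1` within `39·L^i + 2` of `Ω_i(h)` delivers (HOME `D6-AUDIT-alpha2-g2.md` §4).
HONEST FRAMING.  Plumbing; no estimate; count-neutral helper toward R3 2′ (`stub_laneRecordsV3`, items 19935∕19936); nothing about d = 4, the continuum, or a mass gap.

References: T. Bałaban, Commun. Math. Phys. 98 (1985) 17–51 [Balaban1985Averaging] (Props. 1–2 p.26); CMP 102 (1985) 255–275 [Balaban1985UV3] ((42) p.266, (68) p.273).
-/

set_option autoImplicit false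

noncomputable section

namespace Summit.QuantumFields.YangMills.Theorems

open Set
open Literature.MathematicalPhysics.QuantumFieldTheory.Balaban1983to89
open Literature.MathematicalPhysics.QuantumFieldTheory.Balaban1983to89.ExpMeanLog (deltaSU)
open Literature.MathematicalPhysics.QuantumFieldTheory.Balaban1983to89.T3ContinuumYM3Torus
open Literature.MathematicalPhysics.QuantumFieldTheory.Balaban1983to89.B10Eq38TorusDomains (toFine)
open Literature.MathematicalPhysics.QuantumFieldTheory.Balaban1983to89.B10Eq42TorusConstraint (bondsIn lam42 mem_bondsIn_iff)
open Literature.MathematicalPhysics.QuantumFieldTheory.Balaban1983to89.B3Taylor310LocalRemainder (tdist_eq_sum_natAbs tdist_comm)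
open Literature.MathematicalPhysics.QuantumFieldTheory.Balaban1985CMP102.Setting
open Summit.QuantumFields.Balaban3D.Carriers
open Summit.QuantumFields.Balaban3D.Proofs.Primitives (AlphaConsts)
open Summit.QuantumFields.YangMills.BalabanUVNodes.N20LCSAvgDominationRegion (boxRegion mem_boxRegion)
open Summit.QuantumFields.YangMills.Theorems.BalabanUVNodesN08AlphaHistGeom (distTo distTo_le)

/-! ## §1 Boxes versus the `ℓ¹` torus distance -/

/-- The minimal-absolute-value representative of the class of an integer is not longer than the integer. [folklore] -/
theorem natAbs_valMinAbs_intCast_le {n : ℕ} [NeZero n] (e : ℤ) : ((e : ZMod n).valMinAbs).natAbs ≤ e.natAbs :=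
  ZMod.natAbs_min_of_le_div_two n _ e (ZMod.coe_valMinAbs _) (ZMod.natAbs_valMinAbs_le _)

/-- **A PLAQUETTE OF `boxRegion x ρ` HAS ITS BASE POINT WITHIN `ℓ¹` TORUS DISTANCE `d·ρ` OF `x`.** [folklore] -/
theorem tdist_le_of_mem_boxRegion {P : Params} {j : ℕ} {x : Site P j} {ρ : ℕ} {q : Plaq P j} (hq : q ∈ boxRegion x ρ) : Site.tdist q.src x ≤ P.d * ρ := by
  rw [tdist_eq_sum_natAbs]
  have hterm : ∀ ν, ((q.src ν - x ν).valMinAbs).natAbs ≤ ρ := by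
    intro ν
    obtain ⟨e, he, hqe⟩ := (mem_boxRegion.mp hq) ν
    have hsub : q.src ν - x ν = ((e : ℤ) : ZMod (P.sitesPerDir j)) := by rw [hqe]; ring
    rw [hsub]
    have h1 := natAbs_valMinAbs_intCast_le (n := P.sitesPerDir j) e
    have h2 : e.natAbs ≤ ρ := by
      have := abs_le.mp he
      omega
    exact h1.trans h2
  calc ∑ ν : Fin P.d, ((q.src ν - x ν).valMinAbs).natAbs ≤ ∑ _ν : Fin P.d, ρ := Finset.sum_le_sum fun ν _ => hterm ν
    _ = P.d * ρ := by simp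

/-! ## §2 The interface in geometric form -/

section T3

variable {F : T3Family} {𝔠 : AlphaConsts F.L (suGroupModel 2).N} {γ : ℝ} {hγ : 0 < γ} {hγ1 : γ ≤ (min 𝔠.gamma0 1) ^ 2} {K : ℕ}

/-- **★ THE (D6L)-CORE INTERFACE, GEOMETRIC FORM.**  `U ∈ localSmallT3 k h` (`k ≤ K`) as soon as, for all levels `i₀ ≤ i ≤ k`, every FINE plaquette whose base point is within
`ℓ¹` torus distance `39·L^{i₀}` of the read region `lam42 Ω(h) k i` (`= Λ_i(h)` for `i < k`, `= Ω_k(h)` for `i = k`) is `α₀·(L^{i₀})⁻²`-small — `α₀` in [B7] Prop. 2's window at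
`d = 3`, `N = 2` (`C₀(3)α₀ ≤ ⅓`, `2α₀ ≤ 2δ_SU(2)/(7L)²`, `((5L)²/4)(α₀ + 2C₀(3)α₀²) ≤ δ_SU(2)/2`; met by `α₀ = ½C68·g p(g)` on the record's window).
[cite: Balaban1985Averaging, Prop. 2 (52)–(54) p.26 + Prop. 1 (51) p.26; Balaban1985UV3, (42) p.266 + (68) p.273] -/
theorem AlphaInputsT3AC.localSmallT3_of_plaqSmall_near_reads {k : ℕ} (hk : k ≤ K) (h : Hist (F.P K) k) {α₀ : ℝ} (hα : 0 < α₀)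
    (hα3 : (143 * ((((3 + 4 : ℕ) : ℝ)) ^ 2 / 4) ^ 2) * α₀ ≤ 1 / 3)
    (hα2 : 2 * α₀ ≤ 2 * deltaSU (Fin 2) / (((3 + 4) * F.L : ℕ) : ℝ) ^ 2)
    (hδ : ((((3 + 2) * F.L : ℕ) : ℝ) ^ 2 / 4) * (α₀ + 2 * (143 * ((((3 + 4 : ℕ) : ℝ)) ^ 2 / 4) ^ 2) * α₀ ^ 2) ≤ deltaSU (Fin 2) / 2)
    {U : GaugeField (F.P K) 0 (Matrix.specialUnitaryGroup (Fin 2) ℂ)}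
    (hU : ∀ i₀ i : ℕ, i₀ ≤ i → i ≤ k → ∀ q : Plaq (F.P K) 0,
      distTo (S := T3Scales F γ hγ (hγ1.trans (sq_min_one_le _ 𝔠.gamma0_pos)) K)
          (lam42 (Omega 𝔠.lane.carrier.M₁ (rcolOf (T3Scales F γ hγ (hγ1.trans (sq_min_one_le _ 𝔠.gamma0_pos)) K) 𝔠.lane.carrier) k h) k i) q.src ≤
        39 * F.L ^ i₀ →
      dist1 (GaugeField.plaqHol U q) < α₀ * (((F.L : ℝ) ^ i₀)⁻¹) ^ 2) :
    U ∈ AlphaInputsT3AC.localSmallT3 F 𝔠 γ hγ hγ1 K k h := by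
  refine AlphaInputsT3AC.localSmallT3_of_plaqSmallOn_readBoxes (𝔠 := 𝔠) (hγ1 := hγ1) hk h hα hα3 hα2 hδ fun i₀ hi₀ c₀ hc₀ q hq => ?_
  obtain ⟨i, hi₀i, hik, hb⟩ := hc₀
  have hmem : toFine i₀ c₀.src ∈ lam42 (Omega 𝔠.lane.carrier.M₁
      (rcolOf (T3Scales F γ hγ (hγ1.trans (sq_min_one_le _ 𝔠.gamma0_pos)) K) 𝔠.lane.carrier) k h) k i := (mem_bondsIn_iff.mp hb).1
  refine hU i₀ i hi₀i hik q ((distTo_le (S := T3Scales F γ hγ (hγ1.trans (sq_min_one_le _ 𝔠.gamma0_pos)) K) hmem).trans ?_)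
  have ht := tdist_le_of_mem_boxRegion (Finset.mem_coe.mp hq)
  have hd : (F.P K).d = 3 := rfl
  rw [hd] at ht
  show Site.tdist q.src (toFine i₀ c₀.src) ≤ 39 * F.L ^ i₀
  have hL : (F.P K).L = F.L := rfl
  omega

end T3

end Summit.QuantumFields.YangMills.Theorems

end
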